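import Summits.ResolutionOfSingularities.ResolutionOfSingularities.Theorems.SharpStrataSepExcModelsDefs
import Summits.ResolutionOfSingularities.ResolutionOfSingularities.Theorems.SharpStrataSepExcModelsModelDescends
import Summits.ResolutionOfSingularities.ResolutionOfSingularities.Theorems.SharpStrataSepExcModelsSepExcDescendsPart
import Mathlib.AlgebraicGeometry.Morphisms.Proper
import Mathlib.AlgebraicGeometry.ResidueField
import HarnessLib

/-!
# Separable exceptionality descends along proper birational morphisms at points with
# separable residue field extension

Line `birth` of crux `SharpStrata.SepExcModels` (stmt-ResolutionOfSingularities-16828,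
`Cruxes/SepExcModels/Lines/birth.lean`), lead c1, tool stub (T4s, SCHEME form of descent)
`stub_sepExcAt_descends`, PROVED (part II of II; part I = `…SepExcDescendsPart.lean`).

Setting: `π : Y' → Y` proper and birational between integral schemes, `ζ' ∈ Y'`,
`ζ = π(ζ')`, with `κ(ζ') / κ(ζ)` formally smooth, and `Y'` separably exceptional at `ζ'`
(`SepExcAt`, `Theorems/SharpStrataSepExcModelsDefs.lean`: `𝒪_{Y',ζ'}` regular, or `ζ'` closed, or
a finitely generated birational local model `𝒪_{Y',ζ'}[s'] ⊆ K(Y')` with a regular prime over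
`𝔪_{ζ'}` whose quotient is generically smooth over `κ(ζ')`). Conclusion: `Y` is separably
exceptional at `ζ`. Contrapositive for the Kolchin phase (Benito–Piltant–Reguera 2022,
Question 6.6): over a SHARP point, every point of a proper birational model with separable
residue field extension is again sharp.

## Proof

* `ζ'` closed: `π` is universally closed, hence a closed map, so `{ζ} = π({ζ'})` is closed.
* `𝒪_{Y',ζ'}` regular: it is its own model (`model_of_isRegularLocalRing`, part I), so this is
  a special case of the next.
* Model at `ζ'` (`sepExcAt_descends_of_model`): the ring form `ModelDescends.stub_model_descends`
  (landed, T4) at `R = 𝒪_{Y,ζ}`, `R' = 𝒪_{Y',ζ'}`, `K = K(Y')` (an `R`-algebra through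
  `R → R' → K(Y')`), after presenting `R'` as `(R[c])_𝔭` inside `K(Y')`: choose affine opens
  `V = Spec A ∋ ζ` and `V' = Spec A' ∋ ζ'` with `π(V') ⊆ V`; `A'` is of finite type over `A`
  (`π` is locally of finite type), generated by finitely many sections with images `c ⊆ K(Y')`;
  every section of `A'` then lies in `C = R[c]`, `C` lies in the image of the injective
  `R' → K(Y')`, and `R' = A'_{P'}` is the localisation of `C` at `𝔭 = 𝔪_{R'} ∩ C`. The residue
  map `κ(ζ) → κ(ζ')` is `R/𝔪_R → R'/𝔪_{R'}` induced by `R → C → R'` (= the stalk map). The model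
  over `R` inside `K(Y')` produced by the ring form is finally pulled back to `K(Y)` along the
  function field isomorphism of the birational `π`
  (`exists_ringEquiv_functionField_of_isBirational`, `model_of_algEquiv`, part I).

## Sources

* A. Benito, O. Piltant, A. J. Reguera, *Small irreducible components of arc spaces in positive
  characteristic*, J. Pure Appl. Algebra 226 (2022) 107113, Lemma 4.2 (dual statement),
  Question 6.6. [BenitoPiltantReguera2022]
* The Stacks Project, Tag 01RN. [StacksProject]
-/

noncomputable section

-- single-problem summit: the doubled namespace component `ResolutionOfSingularities` is forced
set_option linter.dupNamespace false

open CategoryTheory AlgebraicGeometry TopologicalSpace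
open Literature.AlgebraicGeometry.Resolution IsLocalRing
open Summit.ResolutionOfSingularities.ResolutionOfSingularities.Theorems.SepExcModels

namespace Summit.ResolutionOfSingularities.ResolutionOfSingularities.Theorems.SepExcModels.SepExcDescends

/-- **Descent of a separable regular local model along a birational morphism locally of finite
type, at a point with formally smooth residue field extension.** For `π : Y' → Y` birational and
locally of finite type between integral schemes, `ζ' ∈ Y'` with `κ(ζ')/κ(π ζ')` formally smooth,
and a model `𝒪_{Y',ζ'}[s'] ⊆ K(Y')` with a prime `𝔮'` over `𝔪_{ζ'}`, regular local ring and
`(𝒪_{Y',ζ'}[s']/𝔮')[1/g']` smooth over `κ(ζ')`: `SepExcAt Y (π ζ')`. The ring form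
`ModelDescends.stub_model_descends` at `R = 𝒪_{Y,π ζ'}`, `R' = 𝒪_{Y',ζ'} = (R[c])_𝔭 ⊆ K(Y')`
(affine charts `Spec A' → Spec A`, `A'` of finite type over `A`, `c` = images of generators),
followed by transport of the resulting model from `K(Y')` to `K(Y)` along the function field
isomorphism. [cite: BenitoPiltantReguera2022, Lemma 4.2 (dual statement)] -/
theorem sepExcAt_descends_of_model (Y Y' : Scheme.{0}) [IsIntegral Y] [IsIntegral Y']
    (π : Y' ⟶ Y) [LocallyOfFiniteType π] (hπ : IsBirational π) (ζ' : Y')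
    (hsep : @Algebra.FormallySmooth (Y.residueField (π.base ζ')) (Y'.residueField ζ') _ _
      (π.residueFieldMap ζ').hom.toAlgebra)
    (s' : Finset Y'.functionField)
    (𝔮' : Ideal (Algebra.adjoin (Y'.presheaf.stalk ζ') (s' : Set Y'.functionField)))
    [𝔮'.IsPrime]
    (hle' : maximalIdeal (Y'.presheaf.stalk ζ') ≤ 𝔮'.comap (algebraMap (Y'.presheaf.stalk ζ')
      (Algebra.adjoin (Y'.presheaf.stalk ζ') (s' : Set Y'.functionField))))
    (hreg' : IsRegularLocalRing (Localization.AtPrime 𝔮'))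
    (g' : Algebra.adjoin (Y'.presheaf.stalk ζ') (s' : Set Y'.functionField)) (hg' : g' ∉ 𝔮')
    (hsm' : @Algebra.Smooth (Y'.presheaf.stalk ζ' ⧸ maximalIdeal (Y'.presheaf.stalk ζ')) _
      (Localization.Away (Ideal.Quotient.mk 𝔮' g')) _
      ((algebraMap _ (Localization.Away (Ideal.Quotient.mk 𝔮' g'))).comp
        (Ideal.quotientMap 𝔮' (algebraMap (Y'.presheaf.stalk ζ')
          (Algebra.adjoin (Y'.presheaf.stalk ζ') (s' : Set Y'.functionField))) hle')).toAlgebra) :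
    SepExcAt Y (π.base ζ') := by
  classical
  -- (0) the function fields: `e : K(Y) ≃ K(Y')`, compatible with all stalk maps
  obtain ⟨e, he⟩ := exists_ringEquiv_functionField_of_isBirational hπ
  -- (1) affine charts `V ∋ π ζ'`, `V' ∋ ζ'` with `π(V') ⊆ V`; `A' = Γ(Y', V')` is of finite type
  -- over `A = Γ(Y, V)`, generated by a finite set `t`
  obtain ⟨V, hV, hζV, -⟩ :=
    exists_isAffineOpen_mem_and_subset (X := Y) (x := π.base ζ') (U := ⊤) trivial
  obtain ⟨V', hV', hζ'V', hV'le⟩ :=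
    exists_isAffineOpen_mem_and_subset (X := Y') (x := ζ') (U := π ⁻¹ᵁ V) hζV
  have hle₁ : V' ≤ π ⁻¹ᵁ V := hV'le
  haveI : Nonempty V := ⟨⟨_, hζV⟩⟩
  haveI : Nonempty V' := ⟨⟨ζ', hζ'V'⟩⟩
  haveI : Nonempty ↥(π ⁻¹ᵁ V) := ⟨⟨ζ', hζV⟩⟩
  have hφ : RingHom.FiniteType (π.appLE V V' hle₁).hom :=
    HasRingHomProperty.appLE @LocallyOfFiniteType π ‹_› ⟨V, hV⟩ ⟨V', hV'⟩ hle₁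
  letI algAA' : Algebra Γ(Y, V) Γ(Y', V') := (π.appLE V V' hle₁).hom.toAlgebra
  have hft : Algebra.FiniteType Γ(Y, V) Γ(Y', V') := hφ
  obtain ⟨t, ht⟩ := hft.out
  -- the stalk `R' = 𝒪_{Y',ζ'}` is `A'_{P'}` inside `K(Y')`
  letI := TopCat.Presheaf.algebra_section_stalk Y'.presheaf (⟨ζ', hζ'V'⟩ : V')
  haveI := functionField_isScalarTower Y' V' ⟨ζ', hζ'V'⟩
  haveI := hV'.isLocalization_stalk ⟨ζ', hζ'V'⟩
  have hinjR' : Function.Injective (algebraMap (Y'.presheaf.stalk ζ') Y'.functionField) :=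
    IsFractionRing.injective _ _
  -- (2) `R = 𝒪_{Y,π ζ'} → R' → K(Y')`
  letI algRR' : Algebra (Y.presheaf.stalk (π.base ζ')) (Y'.presheaf.stalk ζ') :=
    (π.stalkMap ζ').hom.toAlgebra
  letI algRK' : Algebra (Y.presheaf.stalk (π.base ζ')) Y'.functionField :=
    ((algebraMap (Y'.presheaf.stalk ζ') Y'.functionField).comp (π.stalkMap ζ').hom).toAlgebra
  haveI : IsScalarTower (Y.presheaf.stalk (π.base ζ')) (Y'.presheaf.stalk ζ') Y'.functionField :=
    IsScalarTower.of_algebraMap_eq fun _ => rfl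
  -- sections of `A` go to germs of `R`: `(φ a)_{η'} = (π♯ a_ζ)_{η'}`
  have hφK : ∀ a : Γ(Y, V), algebraMap Γ(Y', V') Y'.functionField (π.appLE V V' hle₁ a) =
      algebraMap (Y.presheaf.stalk (π.base ζ')) Y'.functionField
        (Y.presheaf.germ V (π.base ζ') hζV a) := by
    have H : π.appLE V V' hle₁ ≫ Y'.germToFunctionField V' =
        Y.presheaf.germ V (π.base ζ') hζV ≫ π.stalkMap ζ' ≫
          Y'.presheaf.stalkSpecializes (genericPoint_specializes ζ') := by
      rw [Scheme.Hom.germ_stalkMap_assoc, TopCat.Presheaf.germ_stalkSpecializes,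
        Scheme.Hom.appLE, Category.assoc]
      congr 1
      exact TopCat.Presheaf.germ_res Y'.presheaf (homOfLE hle₁) _ _
    intro a
    exact DFunLike.congr_fun (CommRingCat.hom_ext_iff.mp H) a
  -- (3) `c` = images of the generators in `K(Y')`, `C = R[c] ⊆ K(Y')`
  let c : Finset Y'.functionField := t.image (algebraMap Γ(Y', V') Y'.functionField)
  let C : Subalgebra (Y.presheaf.stalk (π.base ζ')) Y'.functionField :=
    Algebra.adjoin (Y.presheaf.stalk (π.base ζ')) (c : Set Y'.functionField)
  -- `C` lies in the image of the injective `R' → K(Y')`; `ψ : C → R'`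
  let fA : Y'.presheaf.stalk ζ' →ₐ[Y.presheaf.stalk (π.base ζ')] Y'.functionField :=
    IsScalarTower.toAlgHom _ _ _
  let eR := AlgEquiv.ofInjective fA hinjR'
  have hcC : (c : Set Y'.functionField) ⊆ fA.range := by
    intro x hx
    rw [Finset.coe_image] at hx
    obtain ⟨a, -, rfl⟩ := hx
    exact fA.mem_range.mpr ⟨algebraMap Γ(Y', V') (Y'.presheaf.stalk ζ') a,
      (IsScalarTower.algebraMap_apply Γ(Y', V') (Y'.presheaf.stalk ζ') Y'.functionField a).symm⟩
  have hCle : C ≤ fA.range := Algebra.adjoin_le hcC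
  let ψ : C →ₐ[Y.presheaf.stalk (π.base ζ')] Y'.presheaf.stalk ζ' :=
    (eR.symm : fA.range →ₐ[Y.presheaf.stalk (π.base ζ')] Y'.presheaf.stalk ζ').comp
      (Subalgebra.inclusion hCle)
  letI algCR' : Algebra C (Y'.presheaf.stalk ζ') := ψ.toRingHom.toAlgebra
  have hψK : ∀ x : C, algebraMap (Y'.presheaf.stalk ζ') Y'.functionField
      (algebraMap C (Y'.presheaf.stalk ζ') x) = (x : Y'.functionField) := by
    intro x
    change fA (eR.symm (Subalgebra.inclusion hCle x)) = x
    rw [← AlgEquiv.ofInjective_apply fA hinjR', AlgEquiv.apply_symm_apply,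
      Subalgebra.coe_inclusion]
  haveI : IsScalarTower C (Y'.presheaf.stalk ζ') Y'.functionField :=
    IsScalarTower.of_algebraMap_eq fun x => (hψK x).symm
  have hψR : ∀ r : Y.presheaf.stalk (π.base ζ'),
      algebraMap C (Y'.presheaf.stalk ζ') (algebraMap _ C r) = (π.stalkMap ζ').hom r :=
    fun r => ψ.commutes r
  have hinjψ : Function.Injective (algebraMap C (Y'.presheaf.stalk ζ')) := fun x y hxy =>
    Subtype.ext (by rw [← hψK x, ← hψK y, hxy])
  -- every section of `A'` lies in `C`
  have hA'C : ∀ a : Γ(Y', V'), algebraMap Γ(Y', V') Y'.functionField a ∈ C := by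
    intro a
    have ha : a ∈ Algebra.adjoin Γ(Y, V) (t : Set Γ(Y', V')) := by
      rw [ht]
      exact Algebra.mem_top
    refine Algebra.adjoin_induction (fun x hx => ?_) (fun r => ?_) (fun x y _ _ hx hy => ?_)
      (fun x y _ _ hx hy => ?_) ha
    · exact Algebra.subset_adjoin (Finset.mem_coe.mpr (Finset.mem_image_of_mem _ hx))
    · change algebraMap Γ(Y', V') Y'.functionField (π.appLE V V' hle₁ r) ∈ C
      rw [hφK]
      exact C.algebraMap_mem _
    · rw [map_add]
      exact add_mem hx hy
    · rw [map_mul]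
      exact mul_mem hx hy
  have hA'R' : ∀ a : Γ(Y', V'), algebraMap C (Y'.presheaf.stalk ζ') ⟨_, hA'C a⟩ =
      algebraMap Γ(Y', V') (Y'.presheaf.stalk ζ') a := fun a =>
    hinjR' (by rw [hψK, ← IsScalarTower.algebraMap_apply])
  -- (4) `R' = C_𝔭`, `𝔭 = 𝔪_{R'} ∩ C`
  let 𝔭 : Ideal C := (maximalIdeal (Y'.presheaf.stalk ζ')).comap (algebraMap C (Y'.presheaf.stalk ζ'))
  haveI h𝔭 : 𝔭.IsPrime := Ideal.comap_isPrime _ _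
  haveI : IsLocalization.AtPrime (Y'.presheaf.stalk ζ') 𝔭 := by
    refine ⟨?_, ?_, ?_⟩
    · rintro ⟨x, hx⟩
      exact IsLocalRing.notMem_maximalIdeal.mp hx
    · intro z
      obtain ⟨⟨a, u⟩, hz⟩ :=
        IsLocalization.surj (hV'.primeIdealOf ⟨ζ', hζ'V'⟩).asIdeal.primeCompl z
      refine ⟨⟨⟨_, hA'C a⟩, ⟨⟨_, hA'C u⟩, ?_⟩⟩, ?_⟩
      · change (⟨_, hA'C (u : Γ(Y', V'))⟩ : C) ∉ 𝔭
        rw [Ideal.mem_comap, hA'R', IsLocalization.AtPrime.to_map_mem_maximal_iff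
          (Y'.presheaf.stalk ζ') (hV'.primeIdealOf ⟨ζ', hζ'V'⟩).asIdeal]
        exact u.2
      · change z * algebraMap C _ ⟨_, hA'C (u : Γ(Y', V'))⟩ = algebraMap C _ ⟨_, hA'C a⟩
        rw [hA'R', hA'R']
        exact hz
    · intro x y hxy
      exact ⟨1, by rw [hinjψ hxy]⟩
  -- (5) `R → C → R'` is the (local) stalk map; the residue field extension is `κ(ζ') / κ(ζ)`
  have hloc : maximalIdeal (Y.presheaf.stalk (π.base ζ')) ≤
      (maximalIdeal (Y'.presheaf.stalk ζ')).comap ((algebraMap C (Y'.presheaf.stalk ζ')).comp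
        (algebraMap (Y.presheaf.stalk (π.base ζ')) C)) := by
    intro r hr
    rw [Ideal.mem_comap, RingHom.comp_apply, hψR]
    exact map_nonunit _ r hr
  have hloc₀ : maximalIdeal (Y.presheaf.stalk (π.base ζ')) ≤
      (maximalIdeal (Y'.presheaf.stalk ζ')).comap (π.stalkMap ζ').hom :=
    fun r hr => map_nonunit _ r hr
  have hsep₀ : @Algebra.FormallySmooth (Y.presheaf.stalk (π.base ζ') ⧸ maximalIdeal _)
      (Y'.presheaf.stalk ζ' ⧸ maximalIdeal _) _ _
      (Ideal.quotientMap (maximalIdeal _) (π.stalkMap ζ').hom hloc₀).toAlgebra := hsep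
  have key : (Ideal.quotientMap _ ((algebraMap C (Y'.presheaf.stalk ζ')).comp
      (algebraMap (Y.presheaf.stalk (π.base ζ')) C)) hloc).toAlgebra =
      (Ideal.quotientMap (maximalIdeal _) (π.stalkMap ζ').hom hloc₀).toAlgebra :=
    Algebra.algebra_ext _ _ fun x => by
      obtain ⟨r, rfl⟩ := Ideal.Quotient.mk_surjective x
      change Ideal.quotientMap _ _ hloc (Ideal.Quotient.mk _ r) =
        Ideal.quotientMap _ _ hloc₀ (Ideal.Quotient.mk _ r)
      rw [Ideal.quotientMap_mk, Ideal.quotientMap_mk, RingHom.comp_apply, hψR]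
  have hsep' : @Algebra.FormallySmooth (Y.presheaf.stalk (π.base ζ') ⧸ maximalIdeal _)
      (Y'.presheaf.stalk ζ' ⧸ maximalIdeal _) _ _
      (Ideal.quotientMap _ ((algebraMap C (Y'.presheaf.stalk ζ')).comp
        (algebraMap (Y.presheaf.stalk (π.base ζ')) C)) hloc).toAlgebra := by
    rw [key]
    exact hsep₀
  -- (6) the ring form of descent, inside `K(Y')`
  obtain ⟨s, 𝔮, h𝔮, hle, hreg, g, hg, hsm⟩ := ModelDescends.stub_model_descends c 𝔭
    (Y'.presheaf.stalk ζ') hloc hsep' s' 𝔮' hle' hreg' g' hg' hsm'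
  -- (7) pull the model back to `K(Y)` along `e⁻¹ : K(Y') ≃ₐ[R] K(Y)`
  let eA : Y'.functionField ≃ₐ[Y.presheaf.stalk (π.base ζ')] Y.functionField :=
    AlgEquiv.ofRingEquiv (f := e.symm) fun r => by
      apply e.injective
      rw [e.apply_symm_apply]
      exact (he ζ' r).symm
  haveI := h𝔮
  exact Or.inr (Or.inr (model_of_algEquiv eA s 𝔮 hle hreg g hg hsm))

/-- **STUB (T4s, scheme form of descent): separable exceptionality descends along a proper
birational morphism at points with formally smooth residue field extension.** For `π : Y' → Y`
proper birational between integral schemes locally of finite type over a field and `ζ' ∈ Y'`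
with `κ(ζ')/κ(π ζ')` formally smooth: `SepExcAt Y' ζ' → SepExcAt Y (π ζ')` (closed points go to
closed points under the proper `π`; a regular `𝒪_{Y',ζ'}` is itself a model, `s' = ∅`; the model
case is `stub_model_descends` after identifying `K(Y') = K(Y)`,
`IsBirational.isIso_stalkMap_genericPoint`, and presenting `𝒪_{Y',ζ'}` as a localisation of
`𝒪_{Y,ζ}[c]` through affine charts, `π` being locally of finite type). Contrapositive for the
Kolchin phase: over a SHARP point, every point of the successor with separable residue field
extension is again sharp. [cite: BenitoPiltantReguera2022, Lemma 4.2 (dual statement); folklore] -/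
theorem stub_sepExcAt_descends (k : Type) [Field k] (Y Y' : Scheme.{0}) [IsIntegral Y]
    [IsIntegral Y'] (f : Y ⟶ Spec (.of k)) [LocallyOfFiniteType f] (π : Y' ⟶ Y) [IsProper π]
    (hπ : IsBirational π) (ζ' : Y')
    (hsep : @Algebra.FormallySmooth (Y.residueField (π.base ζ')) (Y'.residueField ζ') _ _
      (π.residueFieldMap ζ').hom.toAlgebra)
    (h : SepExcAt Y' ζ') : SepExcAt Y (π.base ζ') := by
  rcases h with hreg | hcl | ⟨s', 𝔮', h𝔮', hle', hreg', g', hg', hsm'⟩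
  · -- `𝒪_{Y',ζ'}` regular: the trivial model `s' = ∅` upstairs
    obtain ⟨s', 𝔮', h𝔮', hle', hreg', g', hg', hsm'⟩ := model_of_isRegularLocalRing
      (IsFractionRing.injective (Y'.presheaf.stalk ζ') Y'.functionField) hreg
    exact sepExcAt_descends_of_model Y Y' π hπ ζ' hsep s' 𝔮' hle' hreg' g' hg' hsm'
  · -- `ζ'` closed: `π ζ'` is closed, `π` being a closed map
    refine Or.inr (Or.inl ?_)
    have hc := π.isClosedMap _ hcl
    rwa [Set.image_singleton] at hc
  · exact sepExcAt_descends_of_model Y Y' π hπ ζ' hsep s' 𝔮' hle' hreg' g' hg' hsm'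

end Summit.ResolutionOfSingularities.ResolutionOfSingularities.Theorems.SepExcModels.SepExcDescends

end
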